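import Summits.NavierStokesRegularity.NavierStokesRegularity.Theorems.OddMorawetzDefs

/-!
# Route OddMorawetz / `OrderThreeIndefinite` — Gaussian moments and the heat-subordinated Riesz integral

Support file for item stmt-NavierStokesRegularity-1379: the explicit integrals behind the exact evaluation of the
order-3 Euler-derivative form on polynomial-Gaussian fields.
* one-dimensional Gaussian moments `∫ t^{2j} e^{-k t²} = (2j-1)‼/(2k)^j √(π/k)` (Gamma function, Mathlib
  `integral_rpow_mul_exp_neg_mul_rpow`, `Real.Gamma_nat_add_half`), odd moments vanish;
* product structure of `ℝ³ = EuclideanSpace ℝ (Fin 3)` (`PiLp.volume_preserving_ofLp`,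
  `integral_fintype_prod_eq_prod`): monomial Gaussian integrals are products of moments;
* the Fourier-side Riesz-type integrals `∫ ξ^{2α} e^{-k|ξ|²}/|ξ|² dξ` by HEAT SUBORDINATION
  `|ξ|⁻² = ∫₀^∞ e^{-s|ξ|²} ds` and Fubini (Stein, *Singular integrals*, Ch. III §1.3; the same device as the tree's
  `Literature/Analysis/FluidPDE/HeatSubordinatedRiesz.lean`):
  `∫ ξ^{2α} e^{-k|ξ|²}/|ξ|² = (2a-1)‼(2b-1)‼(2c-1)‼ · π√π/2ⁿ · k^{-(n+1/2)}/(n+1/2)`, `n = |α|/2`.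
Everything is proved; no definitions.
-/

noncomputable section

open MeasureTheory SchwartzMap MvPolynomial
open scoped RealInnerProductSpace LineDeriv

-- the problem namespace `Summit.NavierStokesRegularity.NavierStokesRegularity` repeats the summit name by design (D-0017)
set_option linter.dupNamespace false

namespace Summit.NavierStokesRegularity.NavierStokesRegularity.Theorems.OddMorawetz

/-! ### Gaussian moments -/

open Real in
/-- **Even Gaussian moments**: `∫ t^{2j} e^{-k t²} dt = (2j-1)‼ / (2k)^j · √(π/k)` (`0 < k`). -/
theorem integral_pow_even_mul_exp_neg_mul_sq {k : ℝ} (hk : 0 < k) (j : ℕ) :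
    ∫ t : ℝ, t ^ (2 * j) * Real.exp (-k * t ^ 2) =
      (Nat.doubleFactorial (2 * j - 1) : ℝ) / (2 * k) ^ j * Real.sqrt (π / k) := by
  -- reduce to the half-line
  have heven : (fun t : ℝ => t ^ (2 * j) * Real.exp (-k * t ^ 2)) =
      fun t => (fun u : ℝ => u ^ (2 * j) * Real.exp (-k * u ^ 2)) |t| := by
    funext t
    simp only [pow_mul, sq_abs]
  rw [heven, integral_comp_abs (f := fun u : ℝ => u ^ (2 * j) * Real.exp (-k * u ^ 2))]
  -- the half-line integral via the Gamma function
  have hq : (-1 : ℝ) < (2 * j : ℝ) := by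
    have : (0 : ℝ) ≤ 2 * j := by positivity
    linarith
  have hG := integral_rpow_mul_exp_neg_mul_rpow (p := 2) (q := (2 * j : ℝ)) (by norm_num) hq hk
  have hconv : ∫ x in Set.Ioi (0 : ℝ), x ^ (2 * j) * Real.exp (-k * x ^ 2) =
      ∫ x in Set.Ioi (0 : ℝ), x ^ (2 * j : ℝ) * Real.exp (-k * x ^ (2 : ℝ)) := by
    refine setIntegral_congr_fun measurableSet_Ioi fun x hx => ?_
    simp only [Set.mem_Ioi] at hx
    rw [← Real.rpow_natCast, Real.rpow_two, Nat.cast_mul, Nat.cast_ofNat]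
  rw [hconv, hG]
  have h1 : ((2 * j : ℝ) + 1) / 2 = j + 1 / 2 := by ring
  have h2 : -((2 * j : ℝ) + 1) / 2 = -((j : ℝ) + 1 / 2) := by ring
  rw [h1, h2, Real.Gamma_nat_add_half]
  -- k ^ (-(j + 1/2)) = (k^j * √k)⁻¹
  have hk' : k ^ (-((j : ℝ) + 1 / 2)) = (k ^ j * Real.sqrt k)⁻¹ := by
    rw [Real.rpow_neg hk.le, Real.rpow_add hk, Real.rpow_natCast, Real.sqrt_eq_rpow]
  rw [hk', Real.sqrt_div' _ hk.le]
  have hsk : Real.sqrt k ≠ 0 := (Real.sqrt_pos.2 hk).ne'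
  field_simp
  ring

/-- odd moments vanish -/
theorem integral_pow_odd_mul_exp_neg_mul_sq (k : ℝ) (j : ℕ) :
    ∫ t : ℝ, t ^ (2 * j + 1) * Real.exp (-k * t ^ 2) = 0 := by
  have hodd : (fun t : ℝ => (-t) ^ (2 * j + 1) * Real.exp (-k * (-t) ^ 2)) =
      fun t => -(t ^ (2 * j + 1) * Real.exp (-k * t ^ 2)) := by
    funext t
    rw [Odd.neg_pow ⟨j, rfl⟩, neg_sq]; ring
  have h := integral_neg_eq_self (fun t : ℝ => t ^ (2 * j + 1) * Real.exp (-k * t ^ 2)) volume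
  rw [hodd, integral_neg] at h
  linarith

/-- **Product integrals over `ℝ³`**: `∫ ∏ᵢ φᵢ(xᵢ) dx = ∏ᵢ ∫ φᵢ`. -/
theorem integral_prod_coord (φ : Fin 3 → ℝ → ℝ) :
    ∫ x : E3, ∏ i, φ i (x i) = ∏ i, ∫ t : ℝ, φ i t := by
  have h := (PiLp.volume_preserving_ofLp (Fin 3)).integral_comp
    (MeasurableEquiv.toLp 2 (Fin 3 → ℝ)).symm.measurableEmbedding (fun y : Fin 3 → ℝ => ∏ i, φ i (y i))
  rw [← MeasureTheory.integral_fintype_prod_eq_prod, ← MeasureTheory.volume_pi]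
  exact h

/-- the Gaussian factorises over coordinates -/
theorem exp_neg_mul_norm_sq_eq_prod (k : ℝ) (x : E3) :
    Real.exp (-k * ‖x‖ ^ 2) = ∏ i : Fin 3, Real.exp (-k * x i ^ 2) := by
  rw [EuclideanSpace.norm_sq_eq, Finset.mul_sum, Real.exp_sum]
  refine Finset.prod_congr rfl fun i _ => ?_
  rw [Real.norm_eq_abs, sq_abs]

/-- **Monomial Gaussian integrals over `ℝ³`**. -/
theorem integral_monomial_gauss (k : ℝ) (a b c : ℕ) :
    ∫ x : E3, x 0 ^ a * x 1 ^ b * x 2 ^ c * Real.exp (-k * ‖x‖ ^ 2) =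
      (∫ t : ℝ, t ^ a * Real.exp (-k * t ^ 2)) * (∫ t : ℝ, t ^ b * Real.exp (-k * t ^ 2)) *
        (∫ t : ℝ, t ^ c * Real.exp (-k * t ^ 2)) := by
  have h := integral_prod_coord (fun i => fun t => t ^ (![a, b, c] i) * Real.exp (-k * t ^ 2))
  simp only [Fin.prod_univ_three] at h
  simp only [Matrix.cons_val_zero, Matrix.cons_val_one, Matrix.cons_val] at h
  rw [← h]
  refine integral_congr_ae (Filter.Eventually.of_forall fun x => ?_)
  simp only [exp_neg_mul_norm_sq_eq_prod, Fin.prod_univ_three]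
  ring


/-! ### Riesz-type Gaussian integrals `∫ ξ^{2α} e^{-k|ξ|²}/|ξ|² dξ` by heat subordination -/

section Riesz
open Real Set Filter

/-- `∫₀^∞ (k+s)^{-r} ds = k^{1-r}/(r-1)` for `k > 0`, `r > 1`; and integrability. -/
theorem integral_Ioi_add_rpow_neg {k r : ℝ} (hk : 0 < k) (hr : 1 < r) :
    IntegrableOn (fun s : ℝ => (k + s) ^ (-r)) (Ioi 0) ∧
      ∫ s in Ioi (0 : ℝ), (k + s) ^ (-r) = k ^ (1 - r) / (r - 1) := by
  -- antiderivative g(s) = (k+s)^{1-r}/(1-r)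
  set g : ℝ → ℝ := fun s => (k + s) ^ (1 - r) / (1 - r) with hg
  have hr1 : 1 - r ≠ 0 := by linarith
  have hderiv : ∀ s ∈ Ici (0 : ℝ), HasDerivAt g ((k + s) ^ (-r)) s := by
    intro s hs
    have hks : 0 < k + s := by linarith [mem_Ici.1 hs]
    have h1 : HasDerivAt (fun s : ℝ => k + s) 1 s := (hasDerivAt_id s).const_add k
    have h2 := h1.rpow_const (p := 1 - r) (Or.inl hks.ne')
    have h3 := h2.div_const (1 - r)
    refine h3.congr_deriv ?_
    rw [show (1 - r - 1) = -r by ring]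
    field_simp
  have hpos : ∀ s ∈ Ioi (0 : ℝ), 0 ≤ (k + s) ^ (-r) := fun s hs =>
    rpow_nonneg (by linarith [mem_Ioi.1 hs]) _
  have hlim : Tendsto g atTop (nhds 0) := by
    have h1 : Tendsto (fun s : ℝ => k + s) atTop atTop := tendsto_atTop_add_const_left _ _ tendsto_id
    have h2 : Tendsto (fun s : ℝ => (k + s) ^ (1 - r)) atTop (nhds 0) :=
      (tendsto_rpow_neg_atTop (by linarith : 0 < r - 1)).comp h1 |>.congr fun s => by
        simp only [Function.comp_apply]; congr 1; ring
    simpa [hg] using h2.div_const (1 - r)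
  refine ⟨integrableOn_Ioi_deriv_of_nonneg' hderiv hpos hlim, ?_⟩
  rw [integral_Ioi_of_hasDerivAt_of_nonneg' hderiv hpos hlim, hg]
  simp only [add_zero, zero_sub]
  have hr2 : r - 1 ≠ 0 := by linarith
  rw [← neg_div, div_eq_div_iff hr1 hr2]
  ring

/-- products of integrable coordinate functions are integrable on `ℝ³` -/
theorem integrable_prod_coord {φ : Fin 3 → ℝ → ℝ} (h : ∀ i, Integrable (φ i)) :
    Integrable (fun x : E3 => ∏ i, φ i (x i)) := by
  have h1 : Integrable (fun y : Fin 3 → ℝ => ∏ i, φ i (y i)) (volume : Measure (Fin 3 → ℝ)) := by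
    rw [MeasureTheory.volume_pi]; exact Integrable.fintype_prod h
  exact ((PiLp.volume_preserving_ofLp (Fin 3)).integrable_comp_emb
    (MeasurableEquiv.toLp 2 (Fin 3 → ℝ)).symm.measurableEmbedding).2 h1

/-- `t ↦ tⁿ e^{-u t²}` is integrable for `u > 0`. -/
theorem integrable_pow_mul_exp_neg_mul_sq {u : ℝ} (hu : 0 < u) (n : ℕ) :
    Integrable (fun t : ℝ => t ^ n * Real.exp (-u * t ^ 2)) := by
  have h := integrable_rpow_mul_exp_neg_mul_sq hu (s := (n : ℝ)) (by
    have : (0 : ℝ) ≤ n := n.cast_nonneg; linarith)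
  refine h.congr (Eventually.of_forall fun t => ?_)
  simp only [Real.rpow_natCast]

/-- monomial Gaussians are integrable on `ℝ³` (`u > 0` real). -/
theorem integrable_monomial_gauss {u : ℝ} (hu : 0 < u) (a b c : ℕ) :
    Integrable (fun x : E3 => x 0 ^ a * x 1 ^ b * x 2 ^ c * Real.exp (-u * ‖x‖ ^ 2)) := by
  have h := integrable_prod_coord (φ := fun i => fun t => t ^ (![a, b, c] i) * Real.exp (-u * t ^ 2))
    (fun i => integrable_pow_mul_exp_neg_mul_sq hu _)
  refine h.congr (Eventually.of_forall fun x => ?_)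
  simp only [Fin.prod_univ_three, Matrix.cons_val_zero, Matrix.cons_val_one, Matrix.cons_val,
    exp_neg_mul_norm_sq_eq_prod]
  ring

/-- the Gaussian constant in power form: `(√(π/u))³/((2u)^a (2u)^b (2u)^c) = π√π/2ⁿ · u^{-(n+3/2)}`. -/
theorem gauss_const_rpow {u : ℝ} (hu : 0 < u) (a b c : ℕ) :
    Real.sqrt (π / u) ^ 3 / ((2 * u) ^ a * (2 * u) ^ b * (2 * u) ^ c) =
      π * Real.sqrt π / 2 ^ (a + b + c) * u ^ (-((a + b + c : ℕ) + 3 / 2 : ℝ)) := by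
  have hsu : Real.sqrt u ≠ 0 := (Real.sqrt_pos.2 hu).ne'
  have hu' : u ≠ 0 := hu.ne'
  have h1 : u ^ (-((a + b + c : ℕ) + 3 / 2 : ℝ)) = (u ^ (a + b + c) * (u * Real.sqrt u))⁻¹ := by
    rw [Real.rpow_neg hu.le, Real.rpow_add hu, Real.rpow_natCast,
      show (3 / 2 : ℝ) = 1 + 1 / 2 by norm_num, Real.rpow_add hu, Real.rpow_one, Real.sqrt_eq_rpow]
  have h3 : Real.sqrt (π / u) ^ 3 = π * Real.sqrt π / (u * Real.sqrt u) := by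
    rw [Real.sqrt_div' _ hu.le, div_pow, pow_succ, Real.sq_sqrt pi_pos.le, pow_succ, Real.sq_sqrt hu.le]
  rw [h1, h3, mul_pow, mul_pow, mul_pow]
  field_simp
  ring

/-- **Monomial Gaussian integrals in power form** (`u > 0` real, even exponents). -/
theorem integral_monomial_gauss_even {u : ℝ} (hu : 0 < u) (a b c : ℕ) :
    ∫ x : E3, x 0 ^ (2 * a) * x 1 ^ (2 * b) * x 2 ^ (2 * c) * Real.exp (-u * ‖x‖ ^ 2) =
      ((2 * a - 1).doubleFactorial * (2 * b - 1).doubleFactorial * (2 * c - 1).doubleFactorial : ℝ) *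
        (π * Real.sqrt π / 2 ^ (a + b + c)) * u ^ (-((a + b + c : ℕ) + 3 / 2 : ℝ)) := by
  rw [integral_monomial_gauss, integral_pow_even_mul_exp_neg_mul_sq hu, integral_pow_even_mul_exp_neg_mul_sq hu,
    integral_pow_even_mul_exp_neg_mul_sq hu, mul_assoc _ (π * Real.sqrt π / 2 ^ (a + b + c)),
    ← gauss_const_rpow hu a b c]
  have h2 : (2 * u) ≠ 0 := by positivity
  field_simp

/-- Heat-subordination bookkeeping for `ξ^{2α} e^{-k|ξ|²}/|ξ|²`: the pointwise representation
`|ξ|⁻² e^{-k|ξ|²} = ∫₀^∞ e^{-(k+s)|ξ|²} ds` (`ξ ≠ 0`), integrability on the product, and the value of the slices. -/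
theorem riesz_aux {k : ℝ} (hk : 0 < k) (a b c : ℕ) :
    let m : E3 → ℝ := fun ξ => ξ 0 ^ (2 * a) * ξ 1 ^ (2 * b) * ξ 2 ^ (2 * c)
    let F : E3 → ℝ → ℝ := fun ξ s => m ξ * Real.exp (-(k + s) * ‖ξ‖ ^ 2)
    (∀ ξ : E3, ξ ≠ 0 → m ξ * Real.exp (-k * ‖ξ‖ ^ 2) / ‖ξ‖ ^ 2 = ∫ s in Ioi (0 : ℝ), F ξ s) ∧
      Integrable (Function.uncurry F) ((volume : Measure E3).prod (volume.restrict (Ioi (0 : ℝ)))) ∧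
      (∀ s : ℝ, 0 < k + s → ∫ ξ, F ξ s =
        ((2 * a - 1).doubleFactorial * (2 * b - 1).doubleFactorial * (2 * c - 1).doubleFactorial : ℝ) *
          (π * Real.sqrt π / 2 ^ (a + b + c)) * (k + s) ^ (-((a + b + c : ℕ) + 3 / 2 : ℝ))) := by
  intro m F
  set n : ℕ := a + b + c with hn
  have hm : m = fun ξ => ξ 0 ^ (2 * a) * ξ 1 ^ (2 * b) * ξ 2 ^ (2 * c) := rfl
  have hF : F = fun ξ s => m ξ * Real.exp (-(k + s) * ‖ξ‖ ^ 2) := rfl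
  have hm0 : ∀ ξ, 0 ≤ m ξ := fun ξ => by
    simp only [hm, pow_mul]; positivity
  -- Step A: subordination pointwise
  have hA : ∀ ξ : E3, ξ ≠ 0 → m ξ * Real.exp (-k * ‖ξ‖ ^ 2) / ‖ξ‖ ^ 2 = ∫ s in Ioi (0 : ℝ), F ξ s := by
    intro ξ hξ
    have hpos : 0 < ‖ξ‖ ^ 2 := by have := norm_pos_iff.2 hξ; positivity
    have hsplit : ∀ s, F ξ s = m ξ * Real.exp (-k * ‖ξ‖ ^ 2) * Real.exp (-‖ξ‖ ^ 2 * s) := fun s => by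
      show m ξ * Real.exp (-(k + s) * ‖ξ‖ ^ 2) = _
      rw [show -(k + s) * ‖ξ‖ ^ 2 = -k * ‖ξ‖ ^ 2 + -‖ξ‖ ^ 2 * s by ring, Real.exp_add]
      simp only [hm]; ring
    simp_rw [hsplit]
    rw [integral_const_mul, integral_exp_mul_Ioi (by linarith) 0]
    simp only [mul_zero, Real.exp_zero]
    field_simp
  -- Step B: integrability on the product
  have hcontF : Continuous (Function.uncurry F) := by
    simp only [hF, hm, Function.uncurry_def]
    fun_prop
  have hint_slice : ∀ s : ℝ, 0 < k + s → Integrable (fun ξ => F ξ s) := fun s hs => by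
    simpa [hF, hm] using integrable_monomial_gauss hs (2 * a) (2 * b) (2 * c)
  have hval_slice : ∀ s : ℝ, 0 < k + s → ∫ ξ, F ξ s =
      ((2 * a - 1).doubleFactorial * (2 * b - 1).doubleFactorial * (2 * c - 1).doubleFactorial : ℝ) *
        (π * Real.sqrt π / 2 ^ n) * (k + s) ^ (-((n : ℕ) + 3 / 2 : ℝ)) := fun s hs => by
    simpa [hF, hm, hn] using integral_monomial_gauss_even hs a b c
  obtain ⟨hIoi, -⟩ := integral_Ioi_add_rpow_neg hk (r := (n : ℕ) + 3 / 2)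
    (by have : (0 : ℝ) ≤ n := n.cast_nonneg; linarith)
  have hprod : Integrable (Function.uncurry F) ((volume : Measure E3).prod (volume.restrict (Ioi (0 : ℝ)))) := by
    refine (integrable_prod_iff' hcontF.aestronglyMeasurable).2 ⟨?_, ?_⟩
    · rw [ae_restrict_iff' measurableSet_Ioi]
      exact Eventually.of_forall fun s hs => hint_slice s (by linarith [mem_Ioi.1 hs])
    · have heq : EqOn (fun s => ∫ ξ, ‖Function.uncurry F (ξ, s)‖)
          (fun s => ((2 * a - 1).doubleFactorial * (2 * b - 1).doubleFactorial * (2 * c - 1).doubleFactorial : ℝ) *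
            (π * Real.sqrt π / 2 ^ n) * (k + s) ^ (-((n : ℕ) + 3 / 2 : ℝ))) (Ioi 0) := by
        intro s hs
        have hs' : 0 < k + s := by linarith [mem_Ioi.1 hs]
        simp only [Function.uncurry_apply_pair]
        rw [← hval_slice s hs']
        refine integral_congr_ae (Eventually.of_forall fun ξ => ?_)
        simp only [Real.norm_eq_abs, abs_of_nonneg (mul_nonneg (hm0 ξ) (Real.exp_nonneg _)), hF]
      refine IntegrableOn.congr_fun ?_ heq.symm measurableSet_Ioi
      exact hIoi.const_mul _
  exact ⟨hA, hprod, hval_slice⟩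

/-- `ξ^{2α} e^{-k|ξ|²}/|ξ|²` is integrable on `ℝ³`. -/
theorem integrable_monomial_gauss_div_normSq {k : ℝ} (hk : 0 < k) (a b c : ℕ) :
    Integrable (fun ξ : E3 => ξ 0 ^ (2 * a) * ξ 1 ^ (2 * b) * ξ 2 ^ (2 * c) * Real.exp (-k * ‖ξ‖ ^ 2) / ‖ξ‖ ^ 2) := by
  obtain ⟨hA, hprod, -⟩ := riesz_aux hk a b c
  refine hprod.integral_prod_left.congr ?_
  filter_upwards [compl_mem_ae_iff.mpr (measure_singleton (0 : E3))] with ξ hξ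
  exact (hA ξ hξ).symm

/-- **Heat subordination**: `∫ ξ^{2α} e^{-k|ξ|²}/|ξ|² dξ = (2a-1)‼(2b-1)‼(2c-1)‼ · π√π/2ⁿ · k^{-(n+1/2)}/(n+1/2)`,
`n = a+b+c`, via `|ξ|⁻² = ∫₀^∞ e^{-s|ξ|²} ds` and Fubini. -/
theorem integral_monomial_gauss_div_normSq {k : ℝ} (hk : 0 < k) (a b c : ℕ) :
    ∫ ξ : E3, ξ 0 ^ (2 * a) * ξ 1 ^ (2 * b) * ξ 2 ^ (2 * c) * Real.exp (-k * ‖ξ‖ ^ 2) / ‖ξ‖ ^ 2 =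
      ((2 * a - 1).doubleFactorial * (2 * b - 1).doubleFactorial * (2 * c - 1).doubleFactorial : ℝ) *
        (π * Real.sqrt π / 2 ^ (a + b + c)) *
          (k ^ (-((a + b + c : ℕ) + 1 / 2 : ℝ)) / ((a + b + c : ℕ) + 1 / 2)) := by
  obtain ⟨hA, hprod, hval_slice⟩ := riesz_aux hk a b c
  set n : ℕ := a + b + c with hn
  obtain ⟨-, hIoival⟩ := integral_Ioi_add_rpow_neg hk (r := (n : ℕ) + 3 / 2)
    (by have : (0 : ℝ) ≤ n := n.cast_nonneg; linarith)
  calc ∫ ξ : E3, ξ 0 ^ (2 * a) * ξ 1 ^ (2 * b) * ξ 2 ^ (2 * c) * Real.exp (-k * ‖ξ‖ ^ 2) / ‖ξ‖ ^ 2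
      = ∫ ξ : E3, ∫ s in Ioi (0 : ℝ), ξ 0 ^ (2 * a) * ξ 1 ^ (2 * b) * ξ 2 ^ (2 * c) *
          Real.exp (-(k + s) * ‖ξ‖ ^ 2) := by
        refine integral_congr_ae ?_
        filter_upwards [compl_mem_ae_iff.mpr (measure_singleton (0 : E3))] with ξ hξ
        exact hA ξ hξ
    _ = ∫ s in Ioi (0 : ℝ), ∫ ξ : E3, ξ 0 ^ (2 * a) * ξ 1 ^ (2 * b) * ξ 2 ^ (2 * c) *
          Real.exp (-(k + s) * ‖ξ‖ ^ 2) := integral_integral_swap hprod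
    _ = ∫ s in Ioi (0 : ℝ), ((2 * a - 1).doubleFactorial * (2 * b - 1).doubleFactorial *
          (2 * c - 1).doubleFactorial : ℝ) * (π * Real.sqrt π / 2 ^ n) * (k + s) ^ (-((n : ℕ) + 3 / 2 : ℝ)) := by
        refine setIntegral_congr_fun measurableSet_Ioi fun s hs => hval_slice s ?_
        linarith [mem_Ioi.1 hs]
    _ = _ := by
        rw [integral_const_mul, hIoival]
        congr 1
        rw [show (1 : ℝ) - ((n : ℕ) + 3 / 2) = -((n : ℕ) + 1 / 2) by ring,
          show ((n : ℕ) + 3 / 2 : ℝ) - 1 = (n : ℕ) + 1 / 2 by ring]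

/-- the case `k = π²`: `∫ ξ^{2α} e^{-π²|ξ|²}/|ξ|² = (2a-1)‼(2b-1)‼(2c-1)‼ · 2/((2n+1)2ⁿ) · √π/π^{2n}`. -/
theorem integral_monomial_gauss_div_normSq_pi (a b c : ℕ) :
    ∫ ξ : E3, ξ 0 ^ (2 * a) * ξ 1 ^ (2 * b) * ξ 2 ^ (2 * c) * Real.exp (-π ^ 2 * ‖ξ‖ ^ 2) / ‖ξ‖ ^ 2 =
      ((2 * a - 1).doubleFactorial * (2 * b - 1).doubleFactorial * (2 * c - 1).doubleFactorial : ℝ) *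
        (2 / ((2 * (a + b + c : ℕ) + 1) * 2 ^ (a + b + c))) * (Real.sqrt π / π ^ (2 * (a + b + c))) := by
  rw [integral_monomial_gauss_div_normSq (by positivity : 0 < π ^ 2)]
  set n : ℕ := a + b + c
  have hπ := pi_pos
  have h1 : (π ^ 2) ^ (-((n : ℕ) + 1 / 2 : ℝ)) = (π ^ (2 * n) * π)⁻¹ := by
    rw [Real.rpow_neg (by positivity), Real.rpow_add (by positivity), Real.rpow_natCast, ← pow_mul,
      show (π ^ 2) ^ (1 / 2 : ℝ) = π by
        rw [← Real.sqrt_eq_rpow, Real.sqrt_sq hπ.le]]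
  rw [h1]
  have h2 : (2 * (n : ℝ) + 1) ≠ 0 := by positivity
  have h3 : ((n : ℕ) + 1 / 2 : ℝ) = (2 * n + 1) / 2 := by ring
  rw [h3]
  field_simp

end Riesz
end Summit.NavierStokesRegularity.NavierStokesRegularity.Theorems.OddMorawetz
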